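import Summits.HodgeConjecture.CorCM.MultiFieldWeilSimpleThreefoldSimplePartnerAnyCurves
import Summits.HodgeConjecture.CorCM.CMCurvesAndSimpleSurfacesHodge
import HarnessLib

/-!
# MULTI-FIELD WEIL ENGINE — ANY TWO SIMPLE CM ABELIAN VARIETIES OF DIMENSION `≤ 3` AND ANY FINITE FAMILY OF CM ELLIPTIC CURVES: the Hodge conjecture for every
# `A₀^a × A₁^b × ∏_c E_c^{n_c}`, given ONLY Markman's fourfold theorem

Cell `pub-hodgecm2` (COR-CM), seat b30 gen 34 (2026-08-25); count-neutral own lane MULTI-FIELD WEIL ENGINE (stem `MultiFieldWeil*`) — THE CAPSTONE of the gen-34 series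
(`…CurveAbsorption`, `…AnyTwoSimpleThreefoldsAnyCurve`, `…AnyTwoSimpleDimLeThreeAnyCurve`, `…TwoSimpleThreefoldsTwoAbsorbedCurves`, `…AnyTwoSimpleThreefoldsAnyCurves`,
`…SimpleThreefoldSimplePartnerAnyCurves`).  Theorems only; no definition, no named fact, no `sorry`.  HONEST FRAMING: §1 is UNCONDITIONAL (seat p2 ∕ b16's census of curves and
simple surfaces BY NAME); §2 is conditional on the displayed Markman fourfold binder only; `HC_CM` is NOT proved and not asserted.

THE STATEMENT (**`hodgeConjectureFor_prod_any_two_simple_dim_le_three_anyCurves_of_markman`**).  `A₀ ⊨ (K₀; Φ₀)`, `A₁ ⊨ (K₁; Φ₁)` ANY two SIMPLE complex abelian varieties of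
CM type of dimension `≤ 3`; `E_c ⊨ (k_c; Ψ_c)` (`c ∈ I`, finite) ANY CM elliptic curves — isogenous or not, nothing assumed on any field.  Then for every `π : Fin N → Fin 2 ⊕ I`
the Hodge conjecture holds for `⨁_j Sum.elim ![A₀, A₁] E (π j)` — every `A₀^a × A₁^b × ∏_c E_c^{n_c}` in any number and order — GIVEN ONLY
`Markman2025_weilClasses_algebraic_abelianFourfold`; with the dominated form.  Equivalently: **every complex abelian variety of CM type whose simple isogeny factors are CM
elliptic curves (any number) and at most TWO others, of dimension `≤ 3`, satisfies the Hodge conjecture modulo Markman's theorem on the Weil classes of abelian fourfolds.**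
(Seat b16's classification `CorCM/CMAbelianFactorsDimLeThreeClassification` says exactly which of these have all powers divisor-generated — unconditionally; the others carry
exceptional classes, all of which are shown here to come from Weil classes of fourfolds `E × T`.)

PROOF.  A threefold among `A₀, A₁`: the previous file (a simple threefold, any simple partner of dimension `≤ 3`, any curves), after swapping the two if needed.  Both of dimension
`≤ 2` (§1, UNCONDITIONAL): one representative per isogeny class of the whole family `{A₀, A₁} ∪ {E_c}`; the representatives are pairwise non-isogenous CM elliptic curves and
simple CM surfaces among which at most two are surfaces, so no three of their CM fields share a Galois closure (a curve's closure is shared with no other member of a separating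
family, b16's `CMCurvesAndSurfaces.normalClosure_ne_of_finrank_eq_two`), and seat p2's `CMCurvesAndSurfaces.hodgeConjectureFor_prod_curves_simpleSurfaces_of_closures` applies.

[cite: MoonenZarhin1999LowDim, Thm. (0.1), Thm. (0.2), §3 (3.1), Cor. (3.9), §5 (5.2)] [cite: Markman2025SurveySecant, Thm. 1.2] [cite: Gordon1999HodgeAVSurvey, §3 Theorem (proof), 7.4–7.7, 10.10]
[cite: Shimura1998, §6.1 Corollary of Theorem 2 (p. 41), §8.4 (2), §18.1] [cite: MumfordAV1970, §19 Thm. 1 and p. 169]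

## References
* [MoonenZarhin1999LowDim] B. Moonen, Yu. Zarhin, Math. Ann. 315 (1999) 711–733.  [Markman2025SurveySecant] E. Markman, arXiv:2509.23403, Thm. 1.2.
  [Gordon1999HodgeAVSurvey] B. B. Gordon, *A survey of the Hodge conjecture for abelian varieties*, §3, 7.4–7.7, 10.10.  [Shimura1998] G. Shimura, *Abelian varieties with
  complex multiplication and modular functions*, §6.1, §8.4, §18.1.  [MumfordAV1970] D. Mumford, *Abelian Varieties*, §19.
-/

noncomputable section

open CategoryTheory CategoryTheory.Limits NumberField IntermediateField

namespace Summit.HodgeConjecture.CorCM.MultiFieldWeil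

open Literature.AlgebraicGeometry Literature.AlgebraicGeometry.Motives Literature.AlgebraicGeometry.HodgeTheory
open Literature.AlgebraicGeometry.ComplexMultiplication (IsCMTypeRealisation isSimple_iff_isPrimitive)
open Literature.AlgebraicTopology.SingularHomology
open Literature.NumberTheory.ComplexMultiplication

open scoped Classical

section TwoSimpleCurves

variable {I : Type} [Fintype I] {kq : I → Type} [fk : ∀ a, Field (kq a)] [nk : ∀ a, NumberField (kq a)] [ck : ∀ a, IsCMField (kq a)]
  {E : I → AbelianVariety ℂ} {Ψ : ∀ a, CMType (kq a)} {ιE : ∀ a, 𝓞 (kq a) →+* End (E a)} {θE : ∀ a, kq a →+* Module.End ℂ (complexBetti (E a).X 1)}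
  {K₀ K₁ : Type} [fK₀ : Field K₀] [nK₀ : NumberField K₀] [cK₀ : IsCMField K₀] [fK₁ : Field K₁] [nK₁ : NumberField K₁] [cK₁ : IsCMField K₁]
  {A₀ A₁ : AbelianVariety ℂ} {Φ₀ : CMType K₀} {Φ₁ : CMType K₁} {ι₀ : 𝓞 K₀ →+* End A₀} {θ₀ : K₀ →+* Module.End ℂ (complexBetti A₀.X 1)}
  {ι₁ : 𝓞 K₁ →+* End A₁} {θ₁ : K₁ →+* Module.End ℂ (complexBetti A₁.X 1)}

/-! ## §1 Both partners of dimension `≤ 2`: unconditional -/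

set_option maxHeartbeats 400000 in
/-- **ANY TWO SIMPLE CM ABELIAN VARIETIES OF DIMENSION `≤ 2` AND ANY FINITE FAMILY OF CM ELLIPTIC CURVES — UNCONDITIONALLY.**  `A₀ ⊨ (K₀; Φ₀)`, `A₁ ⊨ (K₁; Φ₁)` simple with
`[K_i : ℚ] ∈ {2, 4}` (CM elliptic curves or simple CM surfaces), `E_c ⊨ (k_c; Ψ_c)` CM elliptic curves, isogenous or not.  Then for every `π : Fin N → Fin 2 ⊕ I` the Hodge
conjecture holds for `⨁_j Sum.elim ![A₀, A₁] E (π j)` (representatives of the isogeny classes of the whole family; among them at most two surfaces, so no three CM fields share a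
Galois closure; seat p2's census of curves and simple surfaces). [cite: MoonenZarhin1999LowDim, §3 (3.1), Cor. (3.9)] [cite: Gordon1999HodgeAVSurvey, §3 Theorem (proof), 7.5 and 10.10] -/
theorem hodgeConjectureFor_prod_two_simple_dim_le_two_anyCurves (hd₀ : Module.finrank ℚ K₀ = 2 ∨ Module.finrank ℚ K₀ = 4)
    (hd₁ : Module.finrank ℚ K₁ = 2 ∨ Module.finrank ℚ K₁ = 4) (hA₀ : IsCMTypeRealisation Φ₀ A₀ ι₀ θ₀) (hA₁ : IsCMTypeRealisation Φ₁ A₁ ι₁ θ₁) (hS₀ : A₀.IsSimple)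
    (hS₁ : A₁.IsSimple) (h2 : ∀ a, Module.finrank ℚ (kq a) = 2) (hE : ∀ a, IsCMTypeRealisation (Ψ a) (E a) (ιE a) (θE a)) {N : ℕ} (π : Fin N → Fin 2 ⊕ I) :
    HodgeConjectureFor (⨁ fun j => (Sum.elim ![A₀, A₁] E (π j) : AbelianVariety ℂ)).dim (⨁ fun j => (Sum.elim ![A₀, A₁] E (π j) : AbelianVariety ℂ)).X := by
  -- the family over `Fin 2 ⊕ I` (all identifications below are definitional)
  let Kv : Fin 2 → Type := Fin.cons K₀ (Fin.cons K₁ finZeroElim)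
  let fKv : ∀ i, Field (Kv i) := Fin.cons fK₀ (Fin.cons fK₁ finZeroElim)
  let nKv : ∀ i, NumberField (Kv i) := Fin.cons nK₀ (Fin.cons nK₁ finZeroElim)
  have cKv : ∀ i, IsCMField (Kv i) := Fin.cons cK₀ (Fin.cons cK₁ finZeroElim)
  let Φv : ∀ i : Fin 2, CMType (Kv i) := Fin.cons Φ₀ (Fin.cons Φ₁ finZeroElim)
  let ιv : ∀ i : Fin 2, 𝓞 (Kv i) →+* End ((![A₀, A₁] : Fin 2 → AbelianVariety ℂ) i) := Fin.cons ι₀ (Fin.cons ι₁ finZeroElim)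
  let θv : ∀ i : Fin 2, Kv i →+* Module.End ℂ (complexBetti ((![A₀, A₁] : Fin 2 → AbelianVariety ℂ) i).X 1) := Fin.cons θ₀ (Fin.cons θ₁ finZeroElim)
  have hAv : ∀ i, IsCMTypeRealisation (Φv i) ((![A₀, A₁] : Fin 2 → AbelianVariety ℂ) i) (ιv i) (θv i) := Fin.cons hA₀ (Fin.cons hA₁ finZeroElim)
  have hSv : ∀ i, ((![A₀, A₁] : Fin 2 → AbelianVariety ℂ) i).IsSimple := Fin.forall_fin_two.2 ⟨hS₀, hS₁⟩
  have hdv : ∀ i, Module.finrank ℚ (Kv i) = 2 ∨ Module.finrank ℚ (Kv i) = 4 := Fin.forall_fin_two.2 ⟨hd₀, hd₁⟩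
  let Kf : Fin 2 ⊕ I → Type := Sum.elim Kv kq
  letI instF : ∀ s, Field (Kf s) := fun s => @Sum.rec (Fin 2) I (fun s => Field (Sum.elim Kv kq s)) (fun i => fKv i) (fun a => fk a) s
  letI instN : ∀ s, NumberField (Kf s) := fun s => @Sum.rec (Fin 2) I (fun s => NumberField (Sum.elim Kv kq s)) (fun i => nKv i) (fun a => nk a) s
  haveI instC : ∀ s, IsCMField (Kf s) := fun s => @Sum.rec (Fin 2) I (fun s => IsCMField (Sum.elim Kv kq s)) (fun i => cKv i) (fun a => ck a) s
  let Φf : ∀ s, CMType (Kf s) := fun s => @Sum.rec (Fin 2) I (fun s => CMType (Sum.elim Kv kq s)) (fun i => Φv i) (fun a => Ψ a) s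
  let F : Fin 2 ⊕ I → AbelianVariety ℂ := fun s => Sum.elim ![A₀, A₁] E s
  let ιf : ∀ s, 𝓞 (Kf s) →+* End (F s) :=
    fun s => @Sum.rec (Fin 2) I (fun s => 𝓞 (Sum.elim Kv kq s) →+* End (Sum.elim ![A₀, A₁] E s : AbelianVariety ℂ)) (fun i => ιv i) (fun a => ιE a) s
  let θf : ∀ s, Kf s →+* Module.End ℂ (complexBetti (F s).X 1) :=
    fun s => @Sum.rec (Fin 2) I (fun s => Sum.elim Kv kq s →+* Module.End ℂ (complexBetti (Sum.elim ![A₀, A₁] E s : AbelianVariety ℂ).X 1)) (fun i => θv i)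
      (fun a => θE a) s
  have hAf : ∀ s, IsCMTypeRealisation (Φf s) (F s) (ιf s) (θf s) := by
    rintro (i | a)
    · exact hAv i
    · exact hE a
  have hSf : ∀ s, (F s).IsSimple := by
    rintro (i | a)
    · exact hSv i
    · exact (isSimple_iff_isPrimitive (hE a) (Classical.arbitrary (kq a →+* ℂ))).2
        ((Literature.AlgebraicGeometry.Pohlmann1968.isNondegenerate_of_finrank_eq_two (Ψ a) (h2 a)).isPrimitive _)
  have hdf : ∀ s, Module.finrank ℚ (Kf s) = 2 ∨ Module.finrank ℚ (Kf s) = 4 := by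
    rintro (i | a)
    · exact hdv i
    · exact Or.inl (h2 a)
  have hinr : ∀ a, Module.finrank ℚ (Kf (Sum.inr a)) = 2 := fun a => h2 a
  -- representatives of the isogeny classes of the whole family
  letI : LinearOrder (Fin 2 ⊕ I) := LinearOrder.lift' (Fintype.equivFin (Fin 2 ⊕ I)) (Fintype.equivFin (Fin 2 ⊕ I)).injective
  let cl : Fin 2 ⊕ I → Finset (Fin 2 ⊕ I) := fun s => Finset.univ.filter fun t => AbelianVariety.IsIsogenous (F s) (F t)
  have hcl : ∀ s t, t ∈ cl s ↔ AbelianVariety.IsIsogenous (F s) (F t) := fun s t => by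
    simp only [cl, Finset.mem_filter, Finset.mem_univ, true_and]
  have hne : ∀ s, (cl s).Nonempty := fun s => ⟨s, (hcl s s).2 (AbelianVariety.IsIsogenous.refl (F s))⟩
  let r : Fin 2 ⊕ I → Fin 2 ⊕ I := fun s => (cl s).min' (hne s)
  have hr_iso : ∀ s, AbelianVariety.IsIsogenous (F s) (F (r s)) := fun s => (hcl s (r s)).1 (Finset.min'_mem _ (hne s))
  have hr_le : ∀ s t, AbelianVariety.IsIsogenous (F s) (F t) → r s ≤ r t := fun s t h =>
    Finset.min'_le (cl s) (r t) ((hcl s (r t)).2 (h.trans (hr_iso t)))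
  have hr_eq : ∀ s t, AbelianVariety.IsIsogenous (F s) (F t) → r s = r t := fun s t h => le_antisymm (hr_le s t h) (hr_le t s h.symm')
  have hr_idem : ∀ s, r (r s) = r s := fun s => (hr_eq s (r s) (hr_iso s)).symm
  let J : Type := {t : Fin 2 ⊕ I // r t = t}
  haveI : Nonempty J := ⟨⟨r (Sum.inl 0), hr_idem _⟩⟩
  have hniJ : ∀ j j' : J, j ≠ j' → ¬ AbelianVariety.IsIsogenous (F j.1) (F j'.1) := fun j j' hne' h =>
    hne' (Subtype.ext (by rw [← j.2, ← j'.2]; exact hr_eq _ _ h))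
  let ρ : Fin 2 ⊕ I → J := fun s => ⟨r s, hr_idem s⟩
  have hiso : AbelianVariety.IsIsogenous (⨁ fun l => (Sum.elim ![A₀, A₁] E (π l) : AbelianVariety ℂ)) (⨁ fun l => F (ρ (π l)).1) :=
    AbelianVariety.IsIsogenous.biproduct fun l => hr_iso (π l)
  -- among the representatives no three CM fields share a Galois closure (at most two are surfaces)
  have hsep := Literature.AlgebraicGeometry.Pohlmann1968.CMAlgebra.isSeparatingFamily_of_isSimple_of_pairwise_not_isIsogenous (Φ := fun j : J => Φf j.1) (A := fun j : J => F j.1)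
    (ι := fun j : J => ιf j.1) (θ := fun j : J => θf j.1) (fun j => hAf j.1) (fun j => hSf j.1) hniJ
  have h3 : ∀ i j k : J, i ≠ j → j ≠ k → i ≠ k → normalClosure ℚ (Kf i.1) ℂ = normalClosure ℚ (Kf j.1) ℂ →
      normalClosure ℚ (Kf j.1) ℂ ≠ normalClosure ℚ (Kf k.1) ℂ := by
    intro i j k hij hjk hik hLij
    -- neither `i` nor `j` is a curve slot
    have hi4 : Module.finrank ℚ (Kf i.1) = 4 := by
      rcases hdf i.1 with h | h
      · exact absurd hLij (CMCurvesAndSurfaces.normalClosure_ne_of_finrank_eq_two (K := fun j : J => Kf j.1) (fun j => hdf j.1) hsep hij h)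
      · exact h
    have hj4 : Module.finrank ℚ (Kf j.1) = 4 := by
      rcases hdf j.1 with h | h
      · exact absurd hLij.symm (CMCurvesAndSurfaces.normalClosure_ne_of_finrank_eq_two (K := fun j : J => Kf j.1) (fun j => hdf j.1) hsep hij.symm h)
      · exact h
    -- so `i`, `j` are the two slots `inl 0`, `inl 1`, and `k` is a curve slot
    rcases hdf k.1 with hk2 | hk4
    · exact (CMCurvesAndSurfaces.normalClosure_ne_of_finrank_eq_two (K := fun j : J => Kf j.1) (fun j => hdf j.1) hsep hjk.symm hk2).symm
    · exfalso
      obtain ⟨i₁, hi₁⟩ : ∃ a : Fin 2, i.1 = Sum.inl a := by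
        rcases hi : i.1 with a | c
        · exact ⟨a, rfl⟩
        · rw [hi, hinr] at hi4
          omega
      obtain ⟨j₁, hj₁⟩ : ∃ a : Fin 2, j.1 = Sum.inl a := by
        rcases hj : j.1 with a | c
        · exact ⟨a, rfl⟩
        · rw [hj, hinr] at hj4
          omega
      obtain ⟨k₁, hk₁⟩ : ∃ a : Fin 2, k.1 = Sum.inl a := by
        rcases hk : k.1 with a | c
        · exact ⟨a, rfl⟩
        · rw [hk, hinr] at hk4
          omega
      have hij' : i₁ ≠ j₁ := fun h => hij (Subtype.ext (by rw [hi₁, hj₁, h]))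
      have hjk' : j₁ ≠ k₁ := fun h => hjk (Subtype.ext (by rw [hj₁, hk₁, h]))
      have hik' : i₁ ≠ k₁ := fun h => hik (Subtype.ext (by rw [hi₁, hk₁, h]))
      fin_cases i₁ <;> fin_cases j₁ <;> fin_cases k₁ <;> simp_all
  exact Domination.hodgeConjectureFor_of_avDominatedBy
    ((CMCurvesAndSurfaces.hodgeConjectureFor_prod_curves_simpleSurfaces_of_closures (K := fun j : J => Kf j.1) (A := fun j : J => F j.1) (Φ := fun j : J => Φf j.1)
      (ι := fun j : J => ιf j.1) (θ := fun j : J => θf j.1) (fun j => hdf j.1) (fun j => hAf j.1) (fun j => hSf j.1) hniJ h3 fun l => ρ (π l)).1)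
    (Domination.AVDominatedBy.of_isIsogenous hiso (Domination.AVDominatedBy.refl _))

omit [Fintype I] nk ck nK₀ cK₀ nK₁ cK₁ in
/-- Swapping the two partners: `⨁_j Sum.elim ![A₁, A₀] E (swap (π j)) = ⨁_j Sum.elim ![A₀, A₁] E (π j)` (the families agree pointwise). [folklore] -/
theorem sum_elim_swap_partners {N : ℕ} (π : Fin N → Fin 2 ⊕ I) :
    (fun j => (Sum.elim ![A₁, A₀] E (Sum.map (Equiv.swap (0 : Fin 2) 1) id (π j)) : AbelianVariety ℂ)) =
      fun j => (Sum.elim ![A₀, A₁] E (π j) : AbelianVariety ℂ) := by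
  funext j
  rcases π j with i | c
  · fin_cases i
    · rfl
    · rfl
  · rfl

/-! ## §2 The capstone -/

/-- **MAIN THEOREM — ANY TWO SIMPLE CM ABELIAN VARIETIES OF DIMENSION `≤ 3` AND ANY FINITE FAMILY OF CM ELLIPTIC CURVES, given ONLY Markman's fourfold theorem.**
`A₀ ⊨ (K₀; Φ₀)`, `A₁ ⊨ (K₁; Φ₁)` SIMPLE, of CM type, of dimension `≤ 3`; `E_c ⊨ (k_c; Ψ_c)` (`c ∈ I`, finite) CM elliptic curves — isogenous or not, nothing assumed on any field.
Then for every `π : Fin N → Fin 2 ⊕ I` the Hodge conjecture holds for `⨁_j Sum.elim ![A₀, A₁] E (π j)` — every `A₀^a × A₁^b × ∏_c E_c^{n_c}` — GIVEN ONLY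
`Markman2025_weilClasses_algebraic_abelianFourfold`: every complex abelian variety of CM type whose simple isogeny factors are CM elliptic curves and at most two others of
dimension `≤ 3`.  A threefold among the two: the previous file (after a swap); both of dimension `≤ 2`: §1, unconditionally.  `HC_CM` is NOT asserted.
[cite: MoonenZarhin1999LowDim, Thm. (0.1), Thm. (0.2), §3 (3.1), Cor. (3.9), §5 (5.2)] [cite: Markman2025SurveySecant, Thm. 1.2] [cite: Gordon1999HodgeAVSurvey, §3 Theorem (proof), 7.5–7.7, 10.10] -/
theorem hodgeConjectureFor_prod_any_two_simple_dim_le_three_anyCurves_of_markman (hW4 : Markman2025_weilClasses_algebraic_abelianFourfold)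
    (hA₀ : IsCMTypeRealisation Φ₀ A₀ ι₀ θ₀) (hA₁ : IsCMTypeRealisation Φ₁ A₁ ι₁ θ₁) (hS₀ : A₀.IsSimple) (hS₁ : A₁.IsSimple) (h3₀ : A₀.dim ≤ 3) (h3₁ : A₁.dim ≤ 3)
    (h2 : ∀ a, Module.finrank ℚ (kq a) = 2) (hE : ∀ a, IsCMTypeRealisation (Ψ a) (E a) (ιE a) (θE a)) {N : ℕ} (π : Fin N → Fin 2 ⊕ I) :
    HodgeConjectureFor (⨁ fun j => (Sum.elim ![A₀, A₁] E (π j) : AbelianVariety ℂ)).dim (⨁ fun j => (Sum.elim ![A₀, A₁] E (π j) : AbelianVariety ℂ)).X := by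
  have hd₀ : Module.finrank ℚ K₀ = 2 ∨ Module.finrank ℚ K₀ = 4 ∨ Module.finrank ℚ K₀ = 6 := by
    have h := Literature.AlgebraicGeometry.Pohlmann1968.finrank_eq_two_mul_dim_of_isCMTypeRealisation hA₀
    have hp : 0 < Module.finrank ℚ K₀ := Module.finrank_pos
    interval_cases hd : A₀.dim <;> omega
  have hd₁ : Module.finrank ℚ K₁ = 2 ∨ Module.finrank ℚ K₁ = 4 ∨ Module.finrank ℚ K₁ = 6 := by
    have h := Literature.AlgebraicGeometry.Pohlmann1968.finrank_eq_two_mul_dim_of_isCMTypeRealisation hA₁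
    have hp : 0 < Module.finrank ℚ K₁ := Module.finrank_pos
    interval_cases hd : A₁.dim <;> omega
  by_cases h6₀ : Module.finrank ℚ K₀ = 6
  · -- `A₀` is a threefold
    exact hodgeConjectureFor_prod_simpleThreefold_simple_dim_le_three_anyCurves_of_markman hW4 h6₀ hA₀ hA₁ hS₀ hS₁ h3₁ h2 hE π
  by_cases h6₁ : Module.finrank ℚ K₁ = 6
  · -- `A₁` is a threefold: swap the partners
    have h := hodgeConjectureFor_prod_simpleThreefold_simple_dim_le_three_anyCurves_of_markman hW4 h6₁ hA₁ hA₀ hS₁ hS₀ h3₀ h2 hE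
      fun j => Sum.map (Equiv.swap (0 : Fin 2) 1) id (π j)
    rw [sum_elim_swap_partners π] at h
    exact h
  -- both of dimension `≤ 2`: unconditional
  have hd₀' : Module.finrank ℚ K₀ = 2 ∨ Module.finrank ℚ K₀ = 4 := by
    rcases hd₀ with h | h | h
    · exact Or.inl h
    · exact Or.inr h
    · exact absurd h h6₀
  have hd₁' : Module.finrank ℚ K₁ = 2 ∨ Module.finrank ℚ K₁ = 4 := by
    rcases hd₁ with h | h | h
    · exact Or.inl h
    · exact Or.inr h
    · exact absurd h h6₁
  exact hodgeConjectureFor_prod_two_simple_dim_le_two_anyCurves hd₀' hd₁' hA₀ hA₁ hS₀ hS₁ h2 hE π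

/-- **Dominated form**: everything dominated by a product of copies of two simple CM abelian varieties of dimension `≤ 3` and any CM elliptic curves — every complex abelian
variety of CM type whose simple isogeny factors are CM elliptic curves and at most two others of dimension `≤ 3` — satisfies the Hodge conjecture, given only Markman's fourfold
theorem. [cite: MoonenZarhin1999LowDim, Thm. (0.1), (0.2)] [cite: Markman2025SurveySecant, Thm. 1.2] [cite: MumfordAV1970, §19 Thm. 1 and p. 169] -/
theorem hodgeConjectureFor_of_avDominatedBy_prod_any_two_simple_dim_le_three_anyCurves_of_markman (hW4 : Markman2025_weilClasses_algebraic_abelianFourfold)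
    (hA₀ : IsCMTypeRealisation Φ₀ A₀ ι₀ θ₀) (hA₁ : IsCMTypeRealisation Φ₁ A₁ ι₁ θ₁) (hS₀ : A₀.IsSimple) (hS₁ : A₁.IsSimple) (h3₀ : A₀.dim ≤ 3) (h3₁ : A₁.dim ≤ 3)
    (h2 : ∀ a, Module.finrank ℚ (kq a) = 2) (hE : ∀ a, IsCMTypeRealisation (Ψ a) (E a) (ιE a) (θE a)) {N : ℕ} (π : Fin N → Fin 2 ⊕ I) {X : AbelianVariety ℂ}
    (hX : Domination.AVDominatedBy X (⨁ fun j => (Sum.elim ![A₀, A₁] E (π j) : AbelianVariety ℂ))) : HodgeConjectureFor X.dim X.X :=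
  Domination.hodgeConjectureFor_of_avDominatedBy
    (hodgeConjectureFor_prod_any_two_simple_dim_le_three_anyCurves_of_markman hW4 hA₀ hA₁ hS₀ hS₁ h3₀ h3₁ h2 hE π) hX

end TwoSimpleCurves

end Summit.HodgeConjecture.CorCM.MultiFieldWeil

end
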